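import Summits.BirchSwinnertonDyer.BirchSwinnertonDyer.Theorems.ErratumRoadFiveKatoFframeKummerUnramifiedBadB
import Summits.BirchSwinnertonDyer.BirchSwinnertonDyer.Theorems.ErratumRoadFiveKatoFframeKummerUnramifiedBadC
import Summits.BirchSwinnertonDyer.BirchSwinnertonDyer.Theorems.ErratumRoadFiveKatoFframeLocalIndex
import Summits.BirchSwinnertonDyer.BirchSwinnertonDyer.Theorems.ErratumRoadFiveKatoFframeLocalLift
import Summits.BirchSwinnertonDyer.Rank1Residual.Additive.KatoDescentKummerUnramifiedCompactSide
import HarnessLib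

set_option autoImplicit false

/-!
# Route `ErratumRoadFive`, crux 19715 `EulerHalfNotRamNoInertSetAtFive`, line `kato_Fframe` (r5.4), stub S1Λ
# `stub_katoLambdaLogBoundTamagawa` — HELPER R-C re-thread D: (R1-d) COMPLETED ON THE ROWS WITHOUT THE ADDITIVITY OF `Σ`
# `[S_Σ : Sel_{p^∞}(E/ℚ)] · p^a = ∏_{ℓ∈Σ} p^{v_p(c_ℓ)}` for `Σ ⊇` the bad `ℓ ≠ p` of ANY reduction type

Seat `bsd-line-er5-p1` (LEAD g9), `--supports stmt-BirchSwinnertonDyer-19715` (helper). Theorems only: no definition, no named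
fact, no instance, no notation, no `sorry`. No summit statement is proved here; BSD is proved for no curve.

Part 30 of cell bsd-cm (`Rank1Residual/Additive/KatoDescentKummerUnramifiedCompactSide.lean`,
`KummerUnramified.exists_relIndex_selmerGroup_eq_pow_and_mul_eq`) is (R1-d) on the rows for `Σ` a set of ADDITIVE places.  THIS FILE:

* §1 `exists_relIndex_selmerGroup_eq_pow_and_mul_eq_of_local` — Part 30 §3 VERBATIM with `hQadd` replaced by the three LOCAL BINDERS of
  the LEAD brief `Cruxes/EulerHalfNotRamNoInertSetAtFive/Lines/kato_Fframe_r5_RC_rethread_brief.md`: (I) local index, (L) door lift, (E) one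
  exponent for `E(ℚ_ℓ)[p^∞]`, `ℓ ∈ Σ` (inputs: re-threads A/B/C, Part 28, Part 30 §1–§2, the compact bridge — all reduction-type-free).
* §2 **`exists_relIndex_selmerGroup_eq_pow_and_mul_eq_of_ne`** — THE SAME WITH NO BINDER: (I), (L), (E) are THEOREMS at every finite
  `v ∤ p` (`ErratumRoadFiveKatoFframeLocalIndex.exists_forall_le_relIndex_kummer_sup_unramified_eq_pow_padicValNat_localTamagawaNumber`,
  `ErratumRoadFiveKatoFframeLocalLift.exists_forall_le_lift`, `….exists_exponent_fixed`), so (R1-d) holds for EVERY finite set `Σ ∌ p`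
  containing the bad `ℓ ≠ p` — multiplicative places included.  = Part 30's signature minus `hQadd` (and with `hodd` kept: Poitou–Tate
  at odd `p`).  This is the residual R-C of the S1Λ programme (`Lines/kato_Fframe_r5_RC_brief.md`); the S1Λ closer consumes it through R-D §1.

References: [Kato2004Asterisque] §14.1 (p. 235), §14.8 (p. 238), (14.9.3) (p. 240), §14.18 (p. 244); [Rubin2000] Thm. 1.7.3;
[GreenbergLNM1716] §2–§5; [MilneADT2006] Ch. I Prop. 3.8, Thm. 4.10; [SilvermanAEC2009] VII.§2, VII.6, VIII.§2, X.§4.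
-/

noncomputable section

open scoped Classical NumberField ContRepresentation

open WeierstrassCurve Field IsDedekindDomain NumberField CategoryTheory Literature.NumberTheory.EllipticCurves
  Literature.NumberTheory.EllipticCurves.Kato2004 Literature.NumberTheory.GaloisRepresentations
  Literature.NumberTheory.EllipticCurves.Kato2004.EulerSystemValues
  Literature.NumberTheory.GaloisRepresentations.DiscreteGaloisModule
open WeierstrassCurve (geomPoints geomTorsion galH1Torsion kummerMapTorsion)
open Summit.BirchSwinnertonDyer.Rank1Residual.X11b.Levels Summit.BirchSwinnertonDyer.Rank1Residual.X11b.LocBridge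
open Summit.BirchSwinnertonDyer.Rank1Residual.Additive.GlobalKummer
open Summit.BirchSwinnertonDyer.Rank1Residual.Additive.LevelBridge
open Summit.BirchSwinnertonDyer.Rank1Residual.Additive.KummerUnramified
open Summit.BirchSwinnertonDyer.BirchSwinnertonDyer.Theorems

set_option linter.dupNamespace false

universe u

namespace Summit.BirchSwinnertonDyer.BirchSwinnertonDyer.Theorems.ErratumRoadFiveKatoFframeKummerUnramifiedBad

variable (W : WeierstrassCurve ℚ) [W.IsElliptic] [W.IsGloballyMinimal] (p : ℕ) [hp : Fact p.Prime]
  [ContinuousSMul ℤ_[p] (W.tateModule p)]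

/-! ## §1 (R1-d) on the rows with the three local binders -/

/-- **(R1-d) ON THE ROWS, COMPACT SIDE INCLUDED, reduction-type-free at `Σ`** — Part 30 §3 verbatim with the binders (I) `hidx`, (L) `hlift`,
(E) `eQ/heQ` at the places of `Σ` in place of their additivity: `W/ℚ` globally minimal of rank `1` generated by `P` modulo torsion,
`Ш[p^∞]` finite, `p ∤ #W(ℚ)_tors`, `p` odd, `x = κ_∞(P)`, `Σ ⊆ T` finite sets of places `≠ p` with every bad `ℓ ≠ p` in `Σ`,
`T ⊇ {p} ∪ {bad}`.  THEN `∃ a`, `H¹(ℤ[1/p], T_pW) = ℤ_p ∙ (p^a • x)`, `∃ S_Σ` (Kato's `S(T)`) with `Sel_{p^∞} ≤ S_Σ`,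
**`[S_Σ : Sel_{p^∞}] · p^a = ∏_{ℓ∈Σ} p^{v_p(c_ℓ)}`**, **`∃ k₀ ≥ 1 ∀ k ≥ k₀ ∀ 𝓖': [Sel^{(p^k)} : H¹_{𝓖'}] = p^a`**.
[cite: Kato2004Asterisque, §14.1 (p. 235), §14.8 (p. 238) and (14.9.3) (p. 240)] [cite: Rubin2000, Thm. 1.7.3]
[cite: GreenbergLNM1716, §2, §5] [cite: MilneADT2006, Ch. I Prop. 3.8] -/
theorem exists_relIndex_selmerGroup_eq_pow_and_mul_eq_of_local (hodd : p ≠ 2) (hrank : W.mordellWeilRank = 1)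
    (hsha : Finite (AddCommGroup.primaryComponent W.sha p)) (htors : ¬ p ∣ W.torsionOrder) {P : W.toAffine.Point}
    (hgen : ∀ R : W.toAffine.Point, ∃ n : ℤ, IsOfFinAddOrder (R - n • P)) {x : H1 (tateRep W p) ⊤}
    (hx : ∀ j : ℕ,
      (ofTopSubgroup (W.torsionGaloisModule ((p : ℤ) ^ j)).toTopRep 1).hom (reduceH1Pk W p j ⊤ x) =
        kummerMapTorsion W ((p : ℤ) ^ j) (zsmul_pow_surjective W p j) P)
    (Q T : Finset (HeightOneSpectrum (𝓞 ℚ))) (hQT : Q ⊆ T)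
    (hQp : ∀ v ∈ Q, ((Rat.HeightOneSpectrum.primesEquiv v : Nat.Primes) : ℕ) ≠ p)
    (hidx : ∀ v ∈ Q, ∃ k₁ : ℕ, ∀ k, k₁ ≤ k →
      (W.kummerSelmerStructure ((p ^ k : ℕ) : ℤ) (Sum.inr v)).relIndex
          (W.kummerSelmerStructure ((p ^ k : ℕ) : ℤ) (Sum.inr v) ⊔
            unramifiedSubgroup (GaloisRep.toLocal v (W.torsionGaloisModule ((p ^ k : ℕ) : ℤ))) 1) =
        p ^ padicValNat p ((W.baseChange (v.adicCompletion ℚ)).localTamagawaNumber (v.adicCompletionIntegers ℚ)))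
    (hlift : ∀ v ∈ Q, ∃ k₂ : ℕ, ∀ k, k₂ ≤ k → ∀ y : W.geomPrimaryTorsion p,
      (∀ τ ∈ absInertia (v.adicCompletion ℚ),
        GaloisRep.restrictField (v.adicCompletion ℚ) (primaryGaloisModule W p) τ y = y) →
      (∀ σ : absoluteGaloisGroup (v.adicCompletion ℚ), ∃ z : W.geomPrimaryTorsion p,
        (∀ τ ∈ absInertia (v.adicCompletion ℚ),
          GaloisRep.restrictField (v.adicCompletion ℚ) (primaryGaloisModule W p) τ z = z) ∧
        GaloisRep.restrictField (v.adicCompletion ℚ) (primaryGaloisModule W p) σ y - y = p ^ k • z) →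
      ∃ m : W.geomPrimaryTorsion p,
        (∀ σ : absoluteGaloisGroup (v.adicCompletion ℚ),
          GaloisRep.restrictField (v.adicCompletion ℚ) (primaryGaloisModule W p) σ m = m) ∧
        ∃ z : W.geomPrimaryTorsion p,
          (∀ τ ∈ absInertia (v.adicCompletion ℚ),
            GaloisRep.restrictField (v.adicCompletion ℚ) (primaryGaloisModule W p) τ z = z) ∧
          y - m = p ^ k • z)
    (eQ : ℕ) (heQ : ∀ v ∈ Q, ∀ X : W.geomPrimaryTorsion p,
      (∀ σ : absoluteGaloisGroup (v.adicCompletion ℚ),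
        GaloisRep.restrictField (v.adicCompletion ℚ) (primaryGaloisModule W p) σ X = X) → p ^ eQ • X = 0)
    (hQbad : ∀ v : HeightOneSpectrum (𝓞 ℚ), v ∈ W.badPlaces (𝓞 ℚ) →
      ((Rat.HeightOneSpectrum.primesEquiv v : Nat.Primes) : ℕ) ≠ p → v ∈ Q)
    (hTp : ∀ v : HeightOneSpectrum (𝓞 ℚ), ((p : ℕ) : 𝓞 ℚ) ∈ v.asIdeal → v ∈ T)
    (hTbad : ∀ v : HeightOneSpectrum (𝓞 ℚ), ¬ W.HasGoodReductionAt v → v ∈ T) :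
    ∃ a : ℕ, integralH1 (tateRep W p) p ⊤ = ℤ_[p] ∙ (p ^ a • x) ∧
    ∃ S : AddSubgroup (W.galH1Primary p),
      (∀ y, y ∈ S ↔
        (∀ v : HeightOneSpectrum (𝓞 ℚ), v ∉ Q → y ∈ selmerLocalKerPrimary W (v.adicCompletion ℚ) p) ∧
        (∀ w : InfinitePlace ℚ, y ∈ selmerLocalKerPrimary W w.Completion p) ∧
        (∀ v ∈ Q, galoisCohomology.localization (primaryGaloisModule W p) (Sum.inr v) 1 y ∈
          unramifiedSubgroup (GaloisRep.toLocal v (primaryGaloisModule W p)) 1)) ∧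
      selmerGroupPInfty W p ≤ S ∧ (selmerGroupPInfty W p).relIndex S ≠ 0 ∧
      (selmerGroupPInfty W p).relIndex S * p ^ a =
        ∏ v ∈ Q, p ^ padicValNat p ((W.baseChange (v.adicCompletion ℚ)).localTamagawaNumber (v.adicCompletionIntegers ℚ)) ∧
      ∃ k₀ : ℕ, 1 ≤ k₀ ∧ ∀ k, k₀ ≤ k →
        ∀ (𝓖' : SelmerStructure (W.torsionGaloisModule ((p ^ k : ℕ) : ℤ))),
          (∀ v ∈ Q, 𝓖' (Sum.inr v) = W.kummerSelmerStructure ((p ^ k : ℕ) : ℤ) (Sum.inr v) ⊓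
            unramifiedSubgroup (GaloisRep.toLocal v (W.torsionGaloisModule ((p ^ k : ℕ) : ℤ))) 1) →
          (∀ v ∉ Q, 𝓖' (Sum.inr v) = W.kummerSelmerStructure ((p ^ k : ℕ) : ℤ) (Sum.inr v)) →
          (∀ w : InfinitePlace ℚ, 𝓖' (Sum.inl w) = W.kummerSelmerStructure ((p ^ k : ℕ) : ℤ) (Sum.inl w)) →
          𝓖'.selmerGroup.relIndex (W.kummerSelmerStructure ((p ^ k : ℕ) : ℤ)).selmerGroup = p ^ a := by
  haveI := hsha
  have hp' : p.Prime := hp.out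
  obtain ⟨a, hA, hiff⟩ := exists_integralH1_eq_span_pow_smul W p hrank hsha htors hgen hx
  have hQp' : ∀ v ∈ Q, ((p : ℕ) : 𝓞 ℚ) ∉ v.asIdeal := fun v hv =>
    WeierstrassCurve.natCast_not_mem_asIdeal_of_primesEquiv_ne hp' (hQp v hv)
  -- Part 27′: `S_Σ`, `Sel_{p^∞} ≤ S_Σ`, the product identity for `k ≥ k₀`
  obtain ⟨S, hS, hle, hne, k₀, hk₀, hprod⟩ :=
    exists_addSubgroup_selmerGroupPInfty_le_and_relIndex_mul_eq_of_local W p hodd Q T hQT hQp' hidx hlift hTp hTbad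
  -- Part 28: the exponent killing `Ш[p^∞]`
  obtain ⟨e, he⟩ := exists_forall_pow_smul_mem_ker_primaryH1ToH1 W p
  -- the two `DecidableEq ℚ` instances behind the group law on `W(ℚ)` (ambient / the Literature's classical one) agree
  have hdec : (instDecidableEqRat : DecidableEq ℚ) = fun a b => Classical.propDecidable (a = b) := Subsingleton.elim _ _
  -- no fixed `p^∞`-torsion, hence `ι_k` injective and `M_k = ℤ · κ_{p^k}(P)` (Part 30 §1)
  have hΓ : ∀ Qt : W.geomPrimaryTorsion p,
      (∀ σ : absoluteGaloisGroup ℚ, primaryGaloisModule W p σ Qt = Qt) → Qt = 0 :=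
    geomPrimaryTorsion_eq_zero_of_forall_smul_eq_of_forall W p
      (fun T hT => Summit.BirchSwinnertonDyer.Rank1Residual.Additive.LocPKummer.geomTorsion_eq_zero_of_forall_smul_eq_of_not_dvd_torsionOrder W p htors T hT)
  have hM := comap_range_kummerMapLevel_eq_zmultiples W p (P := P)
    (fun R => by obtain ⟨n, hn⟩ := hgen R; rw [hdec] at hn; exact ⟨n, hn⟩) hΓ
  -- the canonical structure `𝓖₀ k` of the shape at each level
  let 𝓖₀ : ∀ k : ℕ, SelmerStructure (W.torsionGaloisModule ((p ^ k : ℕ) : ℤ)) := fun k u =>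
    match u with
    | Sum.inl w => W.kummerSelmerStructure ((p ^ k : ℕ) : ℤ) (Sum.inl w)
    | Sum.inr v => if v ∈ Q then W.kummerSelmerStructure ((p ^ k : ℕ) : ℤ) (Sum.inr v) ⊓
        unramifiedSubgroup (GaloisRep.toLocal v (W.torsionGaloisModule ((p ^ k : ℕ) : ℤ))) 1
        else W.kummerSelmerStructure ((p ^ k : ℕ) : ℤ) (Sum.inr v)
  have h𝓖₀Q : ∀ k, ∀ v ∈ Q, 𝓖₀ k (Sum.inr v) = W.kummerSelmerStructure ((p ^ k : ℕ) : ℤ) (Sum.inr v) ⊓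
      unramifiedSubgroup (GaloisRep.toLocal v (W.torsionGaloisModule ((p ^ k : ℕ) : ℤ))) 1 := fun k v hv => by
    change (if v ∈ Q then _ else _) = _; rw [if_pos hv]
  have h𝓖₀nQ : ∀ k, ∀ v ∉ Q, 𝓖₀ k (Sum.inr v) = W.kummerSelmerStructure ((p ^ k : ℕ) : ℤ) (Sum.inr v) :=
    fun k v hv => by change (if v ∈ Q then _ else _) = _; rw [if_neg hv]
  -- at every level `k ≥ K₀` and every structure of the shape: one exponent `b` with `[S:Sel] · p^b = C`, minimal, `≤ a`
  obtain ⟨K₀, hK₁, hK₂⟩ : ∃ K₀ : ℕ, k₀ ≤ K₀ ∧ e + eQ ≤ K₀ := ⟨max k₀ (e + eQ), le_max_left _ _, le_max_right _ _⟩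
  have hdata : ∀ k, K₀ ≤ k → ∀ (𝓖' : SelmerStructure (W.torsionGaloisModule ((p ^ k : ℕ) : ℤ))),
      (∀ v ∈ Q, 𝓖' (Sum.inr v) = W.kummerSelmerStructure ((p ^ k : ℕ) : ℤ) (Sum.inr v) ⊓
        unramifiedSubgroup (GaloisRep.toLocal v (W.torsionGaloisModule ((p ^ k : ℕ) : ℤ))) 1) →
      (∀ v ∉ Q, 𝓖' (Sum.inr v) = W.kummerSelmerStructure ((p ^ k : ℕ) : ℤ) (Sum.inr v)) →
      (∀ w : InfinitePlace ℚ, 𝓖' (Sum.inl w) = W.kummerSelmerStructure ((p ^ k : ℕ) : ℤ) (Sum.inl w)) →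
      ∃ b : ℕ, 𝓖'.selmerGroup.relIndex (W.kummerSelmerStructure ((p ^ k : ℕ) : ℤ)).selmerGroup = p ^ b ∧
        (selmerGroupPInfty W p).relIndex S * p ^ b =
          ∏ v ∈ Q, p ^ padicValNat p
            ((W.baseChange (v.adicCompletion ℚ)).localTamagawaNumber (v.adicCompletionIntegers ℚ)) ∧
        kummerMapTorsion W ((p ^ k : ℕ) : ℤ) (zsmul_natCast_pow_surjective W p k) (p ^ b • P) ∈ 𝓖'.selmerGroup ∧ b ≤ a := by
    intro k hk 𝓖' h₁ h₂ h₃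
    obtain ⟨b, hb, hbmem, -, hba⟩ := exists_relIndex_zmultiples_eq_pow_and_mem_and_min W p hx ((hiff a).2 le_rfl) Q hQp k
      𝓖' h₁ h₂ h₃
    have hSel : 𝓖'.selmerGroup.relIndex (W.kummerSelmerStructure ((p ^ k : ℕ) : ℤ)).selmerGroup = p ^ b := by
      rw [relIndex_selmerGroup_eq_relIndex_comap_range_kummerMapLevel_of_le_of_exponent W p Q hQp' eQ heQ e he k
        (hK₂.trans hk) 𝓖' h₁ h₂ h₃, hM k]
      exact hb
    refine ⟨b, hSel, ?_, hbmem, hba⟩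
    rw [← hSel]
    exact hprod k (hK₁.trans hk) 𝓖' h₁ h₂ h₃
  -- the exponent at level `K₀` for the canonical structure
  obtain ⟨b₀, -, hb₀C, -, hb₀a⟩ := hdata K₀ le_rfl (𝓖₀ K₀) (h𝓖₀Q K₀) (h𝓖₀nQ K₀) (fun _ => rfl)
  -- all exponents agree with `b₀`
  have hbeq : ∀ b : ℕ, (selmerGroupPInfty W p).relIndex S * p ^ b =
      ∏ v ∈ Q, p ^ padicValNat p ((W.baseChange (v.adicCompletion ℚ)).localTamagawaNumber (v.adicCompletionIntegers ℚ)) →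
      b = b₀ := fun b hb =>
    Nat.pow_right_injective hp'.two_le (mul_left_cancel₀ hne (hb.trans hb₀C.symm))
  -- `a ≤ b₀`: Part 29's converse, fed by the canonical structures at all levels `≥ K₀`
  have hab : a ≤ b₀ := by
    refine (hiff b₀).1 (pow_smul_mem_integralH1_of_forall_localization_mem W p hx Q hQbad (j := b₀) (k₁ := K₀) ?_)
    intro k hk v hv
    obtain ⟨b, -, hbC, hbmem, -⟩ := hdata k hk (𝓖₀ k) (h𝓖₀Q k) (h𝓖₀nQ k) (fun _ => rfl)
    obtain rfl : b = b₀ := hbeq b hbC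
    exact (kummerMapTorsion_mem_selmerGroup_iff_forall W p k Q (𝓖₀ k) (h𝓖₀Q k) (h𝓖₀nQ k) (fun _ => rfl) _).1 hbmem v hv
  obtain rfl : b₀ = a := le_antisymm hb₀a hab
  refine ⟨b₀, hA, S, hS, hle, hne, hb₀C, max K₀ 1, le_max_right _ _, fun k hk 𝓖' h₁ h₂ h₃ => ?_⟩
  obtain ⟨b, hb, hbC, -, -⟩ := hdata k ((le_max_left _ _).trans hk) 𝓖' h₁ h₂ h₃
  obtain rfl : b = b₀ := hbeq b hbC
  exact hb

/-! ## §2 (R1-d) on the rows for every `Σ ∌ p` containing the bad `ℓ ≠ p` — the binders discharged -/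

/-- **(R1-d) ON THE ROWS FOR `Σ` OF ANY REDUCTION TYPE (R-C of the `kato_Fframe` line).**  Part 30's
`KummerUnramified.exists_relIndex_selmerGroup_eq_pow_and_mul_eq` WITHOUT `hQadd`: for `W/ℚ` globally minimal, `rank_ℤ W(ℚ) = 1`
generated by `P` modulo torsion, `Ш[p^∞]` finite, `p ∤ #W(ℚ)_tors`, `p` odd, `x = κ_∞(P)`, finite sets `Σ ⊆ T` of places `≠ p` with
every bad `ℓ ≠ p` in `Σ` (multiplicative or additive) and `T ⊇ {p} ∪ {bad}`: `∃ a`, `H¹(ℤ[1/p], T_pW) = ℤ_p ∙ (p^a • x)`, `∃ S_Σ` with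
`Sel_{p^∞} ≤ S_Σ`, `[S_Σ : Sel_{p^∞}] ≠ 0`, **`[S_Σ : Sel_{p^∞}] · p^a = ∏_{ℓ∈Σ} p^{v_p(c_ℓ)}`**, and `[Sel^{(p^k)} : H¹_{𝓖'}] = p^a` for
`k ≫ 0`.  The binders (I), (L), (E) of §1 are discharged by `ErratumRoadFiveKatoFframeLocalIndex` / `…LocalLift` at every `ℓ ∈ Σ`.
[cite: Kato2004Asterisque, §14.1 (p. 235), §14.8 (p. 238) and (14.9.3) (p. 240)] [cite: Rubin2000, Thm. 1.7.3]
[cite: GreenbergLNM1716, §2–§5] [cite: MilneADT2006, Ch. I Prop. 3.8] [cite: SilvermanAEC2009, Thm. VII.6.1, Prop. VII.6.3] -/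
theorem exists_relIndex_selmerGroup_eq_pow_and_mul_eq_of_ne (hodd : p ≠ 2) (hrank : W.mordellWeilRank = 1)
    (hsha : Finite (AddCommGroup.primaryComponent W.sha p)) (htors : ¬ p ∣ W.torsionOrder) {P : W.toAffine.Point}
    (hgen : ∀ R : W.toAffine.Point, ∃ n : ℤ, IsOfFinAddOrder (R - n • P)) {x : H1 (tateRep W p) ⊤}
    (hx : ∀ j : ℕ,
      (ofTopSubgroup (W.torsionGaloisModule ((p : ℤ) ^ j)).toTopRep 1).hom (reduceH1Pk W p j ⊤ x) =
        kummerMapTorsion W ((p : ℤ) ^ j) (zsmul_pow_surjective W p j) P)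
    (Q T : Finset (HeightOneSpectrum (𝓞 ℚ))) (hQT : Q ⊆ T)
    (hQp : ∀ v ∈ Q, ((Rat.HeightOneSpectrum.primesEquiv v : Nat.Primes) : ℕ) ≠ p)
    (hQbad : ∀ v : HeightOneSpectrum (𝓞 ℚ), v ∈ W.badPlaces (𝓞 ℚ) →
      ((Rat.HeightOneSpectrum.primesEquiv v : Nat.Primes) : ℕ) ≠ p → v ∈ Q)
    (hTp : ∀ v : HeightOneSpectrum (𝓞 ℚ), ((p : ℕ) : 𝓞 ℚ) ∈ v.asIdeal → v ∈ T)
    (hTbad : ∀ v : HeightOneSpectrum (𝓞 ℚ), ¬ W.HasGoodReductionAt v → v ∈ T) :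
    ∃ a : ℕ, integralH1 (tateRep W p) p ⊤ = ℤ_[p] ∙ (p ^ a • x) ∧
    ∃ S : AddSubgroup (W.galH1Primary p),
      (∀ y, y ∈ S ↔
        (∀ v : HeightOneSpectrum (𝓞 ℚ), v ∉ Q → y ∈ selmerLocalKerPrimary W (v.adicCompletion ℚ) p) ∧
        (∀ w : InfinitePlace ℚ, y ∈ selmerLocalKerPrimary W w.Completion p) ∧
        (∀ v ∈ Q, galoisCohomology.localization (primaryGaloisModule W p) (Sum.inr v) 1 y ∈
          unramifiedSubgroup (GaloisRep.toLocal v (primaryGaloisModule W p)) 1)) ∧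
      selmerGroupPInfty W p ≤ S ∧ (selmerGroupPInfty W p).relIndex S ≠ 0 ∧
      (selmerGroupPInfty W p).relIndex S * p ^ a =
        ∏ v ∈ Q, p ^ padicValNat p ((W.baseChange (v.adicCompletion ℚ)).localTamagawaNumber (v.adicCompletionIntegers ℚ)) ∧
      ∃ k₀ : ℕ, 1 ≤ k₀ ∧ ∀ k, k₀ ≤ k →
        ∀ (𝓖' : SelmerStructure (W.torsionGaloisModule ((p ^ k : ℕ) : ℤ))),
          (∀ v ∈ Q, 𝓖' (Sum.inr v) = W.kummerSelmerStructure ((p ^ k : ℕ) : ℤ) (Sum.inr v) ⊓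
            unramifiedSubgroup (GaloisRep.toLocal v (W.torsionGaloisModule ((p ^ k : ℕ) : ℤ))) 1) →
          (∀ v ∉ Q, 𝓖' (Sum.inr v) = W.kummerSelmerStructure ((p ^ k : ℕ) : ℤ) (Sum.inr v)) →
          (∀ w : InfinitePlace ℚ, 𝓖' (Sum.inl w) = W.kummerSelmerStructure ((p ^ k : ℕ) : ℤ) (Sum.inl w)) →
          𝓖'.selmerGroup.relIndex (W.kummerSelmerStructure ((p ^ k : ℕ) : ℤ)).selmerGroup = p ^ a := by
  classical
  have hp' : p.Prime := hp.out
  have hQp' : ∀ v ∈ Q, ((p : ℕ) : 𝓞 ℚ) ∉ v.asIdeal := fun v hv =>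
    WeierstrassCurve.natCast_not_mem_asIdeal_of_primesEquiv_ne hp' (hQp v hv)
  -- (I) local index
  have hidx := fun v (hv : v ∈ Q) =>
    ErratumRoadFiveKatoFframeLocalIndex.exists_forall_le_relIndex_kummer_sup_unramified_eq_pow_padicValNat_localTamagawaNumber
      W p v (hQp' v hv)
  -- (L) door lift
  have hlift := fun v (hv : v ∈ Q) => ErratumRoadFiveKatoFframeLocalLift.exists_forall_le_lift (p := p) W (v := v) (hQp' v hv)
  -- (E) one exponent for all `ℓ ∈ Σ`
  have hexp : ∀ v : HeightOneSpectrum (𝓞 ℚ), ∃ e : ℕ, v ∈ Q → ∀ X : W.geomPrimaryTorsion p,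
      (∀ σ : absoluteGaloisGroup (v.adicCompletion ℚ),
        GaloisRep.restrictField (v.adicCompletion ℚ) (primaryGaloisModule W p) σ X = X) → p ^ e • X = 0 := fun v => by
    by_cases hv : v ∈ Q
    · obtain ⟨e, he⟩ := ErratumRoadFiveKatoFframeLocalLift.exists_exponent_fixed (p := p) W (v := v) (hQp' v hv)
      exact ⟨e, fun _ => he⟩
    · exact ⟨0, fun h => absurd h hv⟩
  choose f hf using hexp
  have heQ : ∀ v ∈ Q, ∀ X : W.geomPrimaryTorsion p,
      (∀ σ : absoluteGaloisGroup (v.adicCompletion ℚ),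
        GaloisRep.restrictField (v.adicCompletion ℚ) (primaryGaloisModule W p) σ X = X) → p ^ Q.sup f • X = 0 := by
    intro v hv X hX
    obtain ⟨j, hj⟩ := Nat.exists_eq_add_of_le (Finset.le_sup (f := f) hv)
    rw [hj, pow_add, mul_comm, mul_smul, hf v hv X hX, smul_zero]
  exact exists_relIndex_selmerGroup_eq_pow_and_mul_eq_of_local W p hodd hrank hsha htors hgen hx Q T hQT hQp hidx hlift
    (Q.sup f) heQ hQbad hTp hTbad

end Summit.BirchSwinnertonDyer.BirchSwinnertonDyer.Theorems.ErratumRoadFiveKatoFframeKummerUnramifiedBad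

end
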